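import Literature.AlgebraicGeometry.Motives.AbelianVarietyProjective
import Literature.AlgebraicGeometry.Motives.AbelianVarietyDegree
import HarnessLib

/-!
# Base change of homomorphisms of abelian varieties: `deg [n]_A` and `#A[n](L)` do not depend on
# the ground field

The named fact `Literature.AbelianVariety.kerRank_zsmul_id A` (`Motives/AbelianVarietyTorsion`:
`deg [n]_A = dim_K Γ(A[n], 𝒪) = n^{2g}` for `n ≠ 0`; Görtz–Wedhorn, *Algebraic Geometry II*,
Prop. 27.186) and its consequence `natCard_torsionPoints_of_isAlgClosed A L` (`#A[n](L) = n^{2g}`,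
Prop. 27.188 (1); Mumford, *Abelian Varieties*, §6, Application 3) are reduced in
`Motives/AbelianVarietyDegree` to line-bundle facts *over the ground field `K` of `A`*: asymptotic
Riemann–Roch (Prop. 23.83), the degree of pullbacks (Prop. 23.84), the theorem of the cube
(Prop. 27.184) and the projectivity of `A` (Prop. 27.174) — the last one being, as printed in
Mumford (§6, Application 1, p. 62), a statement over an *algebraically closed* field, extended to
arbitrary `K` in `Motives/AbelianVarietyProjective` only at the price of a further named fact
(descent of projectivity, Görtz–Wedhorn I, Prop. 14.57).

This file proves that both statements are **insensitive to extension of the ground field**, so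
that every input may be taken over `K̄` (or over the algebraically closed field `L` in which the
torsion points are counted), which is Mumford's standing hypothesis:

* `AbelianVariety.Hom.baseChange`, `baseChangeFunctor`: the base change `f ↦ f_L = f ×_K L` of
  homomorphisms along a field extension `L / K` (Görtz–Wedhorn I, (4.7); the group structure of
  `A_L` is the one of `AbelianVariety.baseChange`, `Motives/AbelianVarietyProjective`, transported
  along the monoidal functor `Over.pullback`), an **additive functor**
  `AbelianVariety K ⥤ AbelianVariety L`; hence `([n]_A)_L = [n]_{A_L}` (`baseChange_zsmul_id`);
* `isPullback_toSchemeHom_baseChange`: `f_L` is the base change of `f` (cartesian square);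
* `IsIsogeny.baseChange`: isogenies are stable under base change (surjective and finite morphisms
  are; Görtz–Wedhorn I, Prop. 4.32 (2) and Prop. 12.11 (2));
* `IsIsogeny.kerRank_baseChange`: **`deg f_L = deg f`** — the degree `dim_K Γ(Ker f, 𝒪)`
  (`Hom.kerRank`, Görtz–Wedhorn II, Cor. 27.177) is the constant rank of the finite flat morphism
  `f` (`IsIsogeny.finrank_eq_kerRank`, `Motives/AbelianVarietyDegree`), and the rank of a finite
  locally free morphism is the vector-space dimension of its fibres (Görtz–Wedhorn I, Prop. 12.21),
  unchanged under base change (Mathlib `Scheme.Hom.finrank_of_isPullback`);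
* `kerRank_zsmul_id_iff_baseChange`: given `isIsogeny_zsmul_id A`, **`kerRank_zsmul_id A_L ↔
  kerRank_zsmul_id A`** (`dim A_L = dim A`, `AbelianVariety.dim_baseChange`); unconditionally
  `deg [n]_{A_L} = deg [n]_A` for `n` invertible in `K` (`kerRank_zsmul_id_baseChange`);
* `pointsMulEquiv`: **`A(L) ≃* A_L(L)`** (the adjunction `Over.map ⊣ Over.pullback`, multiplicative
  because the group law of `A_L` is the base change of that of `A`), whence
  `#A_L[n](L) = #A[n](L)` (`natCard_torsionPoints_baseChange`) and
  **`natCard_torsionPoints_of_isAlgClosed A_L L → natCard_torsionPoints_of_isAlgClosed A L`**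
  (`natCard_torsionPoints_of_isAlgClosed_of_baseChange`), in particular the torsion count for `A`
  at `L` follows from the single named fact `kerRank_zsmul_id A_L`
  (`natCard_torsionPoints_of_isAlgClosed_of_kerRank_baseChange`);
* assemblies: `kerRank_zsmul_id A` from `isIsogeny_zsmul_id A`, Görtz–Wedhorn II Prop. 23.83,
  23.84, the theorem of the cube for `A_{K̄}` and `IsProjectiveOver A_{K̄}` (Mumford §6,
  Application 1 as printed) — `kerRank_zsmul_id_of_isProjectiveOver_algebraicClosure`,
  `kerRank_zsmul_id_of_namedFacts_algebraicClosure`; and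
  `natCard_torsionPoints_of_isAlgClosed A L` from the same facts over the algebraically closed `L`
  alone, with no hypothesis on `[n]_A` for `p ∣ n`
  (`natCard_torsionPoints_of_isAlgClosed_of_namedFacts_baseChange`).

## Design notes

* `bcFunctor K L = Over.pullback (Spec L → Spec K)` is a *reducible* synonym of `Literature.baseChange K L`
  (a `def`), so that Mathlib's cartesian-monoidal structure on `Over.pullback`
  (`Mathlib.CategoryTheory.Monoidal.Cartesian.Over`) and the transported group structure
  `Functor.grpObjObj` (which *is* the group structure of `AbelianVariety.baseChange`,
  `baseChange_toGrp`) are found by unification; `Hom.baseChange f` is Mathlib's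
  `Functor.mapGrp` on the underlying homomorphism of group schemes.
* Additivity of base change is Mathlib's `Functor.map_mul` (a monoidal functor induces monoid
  homomorphisms on `Hom(X, M)`), multiplicativity of `A(L) ≃ A_L(L)` is `Functor.map_mul` plus
  `MonObj.comp_mul`; the adjunction `Over.mapPullbackAdj` has `homEquiv f = unit ≫ G.map f` by
  definition.
* Mathlib searched and used: `Over.pullback_map_left`, `Over.mapPullbackAdj`,
  `Functor.mapGrp`, `Functor.map_mul`, `Functor.homMonoidHom`, `Functor.map_zsmul`,
  `MorphismProperty.of_isPullback` with the instances `IsStableUnderBaseChange @Surjective`,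
  `@IsFinite`, `Scheme.Hom.finrank_of_isPullback` (`Morphisms/FlatRank`), `IsPullback.of_right`,
  `Equiv.subtypeEquiv`, `Nat.card_congr`. Mathlib has no bundled abelian varieties, isogenies or
  degrees of isogenies; descent of `IsFinite` along fpqc covers (which would give the converse
  `IsIsogeny f_L → IsIsogeny f`) is not in Mathlib (`Morphisms/FlatDescent` covers isomorphisms,
  open immersions, universally closed/open/injective, surjective, and `LocalFlatDescent` the local
  properties), so `isIsogeny_zsmul_id A` is kept as a hypothesis over `K` where needed.

## References

* U. Görtz, T. Wedhorn, *Algebraic Geometry I: Schemes*, 2nd ed. (2020),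
  doi:10.1007/978-3-658-30733-2: Prop. 4.16 (transitivity of fibre products, PDF p. 127 of the
  held copy), Section (4.7) (base change functor; `Hom_S(T, X) = Hom_{S'}(T, X_{(S')})`, PDF p. 135),
  Prop. 4.32 (2) (surjectivity is stable under base change, PDF p. 137), Prop. 12.11 (2) (finite
  morphisms are stable under base change, PDF p. 410), Prop. 12.21 (degree of a finite locally free
  morphism = dimension of the fibre, PDF p. 414), Remark 16.54 (abelian varieties, PDF p. 678).
  [GortzWedhorn2020]
* U. Görtz, T. Wedhorn, *Algebraic Geometry II: Cohomology of Schemes* (2023),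
  doi:10.1007/978-3-658-43031-3: Cor. 27.177 and the definition of the degree of an isogeny
  (p. 882), Prop. 27.186–27.188 (pp. 887–888). [GortzWedhorn2023]
* D. Mumford, *Abelian Varieties* (1970): §4; §6, Application 1 (p. 62) and Application 3
  (Proposition p. 64) (`k` algebraically closed throughout; not held by the literature store,
  locators as cited in `AbelianVariety.lean`). [MumfordAV1970]
* R. Hartshorne, *Algebraic Geometry* (1977), II.3 (base extension; `X(L) = X_L(L)`).
  [Hartshorne1977]
-/

universe u

open CategoryTheory CategoryTheory.Limits AlgebraicGeometry MonoidalCategory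

noncomputable section

namespace Literature.AlgebraicGeometry.Motives

namespace AbelianVariety

open scoped MonObj Obj

variable (K : Type u) [Field K] (L : Type u) [Field L] [Algebra K L]

/-- The morphism `Spec L → Spec K` of a field extension (`Spec` of the structure map). [folklore] -/
abbrev bcSpec : Spec (.of L) ⟶ Spec (.of K) := Spec.map (CommRingCat.ofHom (algebraMap K L))

/-- The base-change functor `X ↦ X ×_K L` on `K`-schemes, *as* Mathlib's `Over.pullback` (a
reducible synonym of `Literature.baseChange K L`, so that Mathlib's cartesian-monoidal structure on
`Over.pullback` is found by instance search). [folklore] -/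
abbrev bcFunctor : SchemeOver K ⥤ SchemeOver L := Over.pullback (bcSpec K L)

/-- `Literature.baseChange K L` is `bcFunctor K L` (by `rfl`). [folklore] -/
theorem baseChange_eq_bcFunctor : Literature.AlgebraicGeometry.Motives.baseChange K L = bcFunctor K L := rfl

variable {K}

/-- The group `K`-scheme underlying `A_L` is the image of that of `A` under the monoidal functor
`bcFunctor K L` (Mathlib `Functor.mapGrp`), by construction of `AbelianVariety.baseChange`. [folklore] -/
theorem baseChange_toGrp (A : AbelianVariety K) :
    (A.baseChange L).toGrp = (bcFunctor K L).mapGrp.obj A.toGrp := rfl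

variable {A B C : AbelianVariety K}

/-- **Base change of a homomorphism of abelian varieties** along a field extension `L / K`:
`f_L = f ×_K L : A_L → B_L`, a homomorphism for the base-changed group structures (Mathlib
`Functor.mapGrp` for the monoidal functor `Over.pullback`; Görtz–Wedhorn I, Remark 16.54;
Mumford, *Abelian Varieties*, §4). [folklore] -/
def Hom.baseChange (f : A ⟶ B) : A.baseChange L ⟶ B.baseChange L :=
  InducedCategory.homMk ((bcFunctor K L).mapGrp.map f.hom)

/-- The homomorphism of `L`-group schemes underlying `f_L` is `Over.pullback` (base change) of the
one underlying `f`. [folklore] -/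
@[simp]
theorem Hom.baseChange_hom_hom_hom (f : A ⟶ B) :
    (Hom.baseChange L f).hom.hom.hom = (bcFunctor K L).map f.hom.hom.hom := rfl

/-- `f_L` commutes with the projections to `A`, `B`: `f_L ≫ pr_B = pr_A ≫ f`. [folklore] -/
@[reassoc]
theorem toSchemeHom_baseChange_comp_fst (f : A ⟶ B) :
    Hom.toSchemeHom (Hom.baseChange L f) ≫ pullback.fst B.X.hom (bcSpec K L) =
      pullback.fst A.X.hom (bcSpec K L) ≫ Hom.toSchemeHom f :=
  pullback.lift_fst _ _ _

/-- `f_L` is a morphism over `Spec L`: `f_L ≫ (B_L → Spec L) = (A_L → Spec L)`. [folklore] -/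
@[reassoc]
theorem toSchemeHom_baseChange_comp_snd (f : A ⟶ B) :
    Hom.toSchemeHom (Hom.baseChange L f) ≫ pullback.snd B.X.hom (bcSpec K L) =
      pullback.snd A.X.hom (bcSpec K L) :=
  pullback.lift_snd _ _ _

/-- **`f_L` is the base change of `f`**: the square `A_L → B_L` over `A → B` (vertical maps the
projections) is cartesian (pasting of the cartesian squares defining `A_L` and `B_L`;
Görtz–Wedhorn I, Prop. 4.16, transitivity of fibre products). [folklore] -/
theorem isPullback_toSchemeHom_baseChange (f : A ⟶ B) :
    IsPullback (Hom.toSchemeHom (Hom.baseChange L f)) (pullback.fst A.X.hom (bcSpec K L))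
      (pullback.fst B.X.hom (bcSpec K L)) (Hom.toSchemeHom f) := by
  refine IsPullback.of_right ?_ (toSchemeHom_baseChange_comp_fst L f)
    (IsPullback.of_hasPullback B.X.hom (bcSpec K L)).flip
  rw [toSchemeHom_baseChange_comp_snd, toSchemeHom_comp_hom]
  exact (IsPullback.of_hasPullback A.X.hom (bcSpec K L)).flip

/-- Base change of the identity. [folklore] -/
@[simp]
theorem Hom.baseChange_id (A : AbelianVariety K) : Hom.baseChange L (𝟙 A) = 𝟙 (A.baseChange L) := by
  apply hom_ext
  change (bcFunctor K L).map (𝟙 A.X) = 𝟙 _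
  rw [(bcFunctor K L).map_id]

/-- Base change of a composite. [folklore] -/
@[simp]
theorem Hom.baseChange_comp (f : A ⟶ B) (g : B ⟶ C) :
    Hom.baseChange L (f ≫ g) = Hom.baseChange L f ≫ Hom.baseChange L g := by
  apply hom_ext
  change (bcFunctor K L).map (f.hom.hom.hom ≫ g.hom.hom.hom) = _
  rw [(bcFunctor K L).map_comp]
  rfl

/-- The sum of homomorphisms on underlying group-scheme maps is the product in Mathlib's
`Hom.commGroup`. [folklore] -/
theorem hom_hom_hom_add (f g : A ⟶ B) : (f + g).hom.hom.hom = f.hom.hom.hom * g.hom.hom.hom := rfl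

/-- **Base change is additive**: `(f + g)_L = f_L + g_L` (the group law of `B_L` is the base
change of that of `B`; Mathlib `Functor.map_mul` for monoidal functors). [folklore] -/
theorem Hom.baseChange_add (f g : A ⟶ B) :
    Hom.baseChange L (f + g) = Hom.baseChange L f + Hom.baseChange L g := by
  apply hom_ext
  rw [hom_hom_hom_add, Hom.baseChange_hom_hom_hom, hom_hom_hom_add, Hom.baseChange_hom_hom_hom,
    Hom.baseChange_hom_hom_hom]
  exact Functor.map_mul (bcFunctor K L) _ _

variable (K) in
/-- **The base-change functor `A ↦ A_L` on abelian varieties** (Görtz–Wedhorn I, Remark 16.54;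
Mumford, *Abelian Varieties*, §4). [folklore] -/
def baseChangeFunctor : AbelianVariety K ⥤ AbelianVariety L where
  obj A := A.baseChange L
  map f := Hom.baseChange L f
  map_id A := Hom.baseChange_id L A
  map_comp f g := Hom.baseChange_comp L f g

/-- `A ↦ A_L` is an additive functor. [folklore] -/
instance : (baseChangeFunctor K L).Additive where
  map_add := Hom.baseChange_add L _ _

/-- **`[n]` commutes with base change**: `([n]_A)_L = [n]_{A_L}`. [folklore] -/
theorem baseChange_zsmul_id (A : AbelianVariety K) (n : ℤ) :
    Hom.baseChange L (n • 𝟙 A) = n • 𝟙 (A.baseChange L) := by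
  have h := (baseChangeFunctor K L).map_zsmul (f := 𝟙 A) (r := n)
  rw [(baseChangeFunctor K L).map_id] at h
  exact h

/-! ### Isogenies and their degrees under base change -/

/-- **Isogenies are stable under base change**: if `f` is surjective and finite, so is `f_L`
(both properties are stable under base change: Görtz–Wedhorn I, Prop. 4.32 (2) and
Prop. 12.11 (2); Mathlib instances `IsStableUnderBaseChange @Surjective`, `@IsFinite`).
[folklore] -/
theorem IsIsogeny.baseChange {f : A ⟶ B} (hf : IsIsogeny f) : IsIsogeny (Hom.baseChange L f) :=
  ⟨MorphismProperty.of_isPullback (P := @Surjective)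
      (isPullback_toSchemeHom_baseChange L f).flip hf.1,
    MorphismProperty.of_isPullback (P := @IsFinite)
      (isPullback_toSchemeHom_baseChange L f).flip hf.2⟩

/-- Isogenous abelian varieties stay isogenous after base change. [folklore] -/
theorem IsIsogenous.baseChange (h : IsIsogenous A B) : IsIsogenous (A.baseChange L) (B.baseChange L) := by
  obtain ⟨f, hf⟩ := h
  exact ⟨Hom.baseChange L f, hf.baseChange L⟩

/-- **The degree of an isogeny is invariant under base change**: `deg f_L = deg f`, i.e.
`dim_L Γ(Ker f_L, 𝒪) = dim_K Γ(Ker f, 𝒪)` (`Hom.kerRank`; Görtz–Wedhorn II, Cor. 27.177, p. 882: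
"the degree of `f` is defined as the degree of the finite locally free morphism `Ker(f) → S`").
Proof: `deg f`, resp. `deg f_L`, is the constant rank of the finite flat morphism `f`, resp. `f_L`
(`IsIsogeny.finrank_eq_kerRank`), the rank of a finite locally free morphism is the dimension of
its fibres (Görtz–Wedhorn I, Prop. 12.21: `deg π = dim_{κ(y)} Γ(X_y, 𝒪_{X_y})`), and `f_L` is the
base change of `f` (`isPullback_toSchemeHom_baseChange`; Mathlib
`Scheme.Hom.finrank_of_isPullback`). [folklore] -/
theorem IsIsogeny.kerRank_baseChange {f : A ⟶ B} (hf : IsIsogeny f) :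
    Hom.kerRank (Hom.baseChange L f) = Hom.kerRank f := by
  haveI := hf.2
  haveI : Flat (Hom.toSchemeHom f) := IsIsogeny.flat_toSchemeHom_holds hf
  obtain ⟨y⟩ := (inferInstance : Nonempty (B.baseChange L).X.left)
  rw [← (hf.baseChange L).finrank_eq_kerRank y,
    ← hf.finrank_eq_kerRank (pullback.fst B.X.hom (bcSpec K L) y)]
  exact Scheme.Hom.finrank_of_isPullback _ _ _ _ (isPullback_toSchemeHom_baseChange L f).flip y

/-- `[n]_{A_L}` is an isogeny as soon as `[n]_A` is. [folklore] -/
theorem isIsogeny_zsmul_id_baseChange_of (A : AbelianVariety K) {n : ℤ} (h : IsIsogeny (n • 𝟙 A)) :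
    IsIsogeny (n • 𝟙 (A.baseChange L)) := by
  rw [← baseChange_zsmul_id]; exact h.baseChange L

/-- `deg [n]_{A_L} = deg [n]_A` as soon as `[n]_A` is an isogeny. [folklore] -/
theorem kerRank_zsmul_id_baseChange_of (A : AbelianVariety K) {n : ℤ} (h : IsIsogeny (n • 𝟙 A)) :
    Hom.kerRank (n • 𝟙 (A.baseChange L)) = Hom.kerRank (n • 𝟙 A) := by
  rw [← baseChange_zsmul_id]; exact h.kerRank_baseChange L

/-- An integer is nonzero in `L ⊇ K` iff it is nonzero in `K`. [folklore] -/
theorem intCast_ne_zero_iff (n : ℤ) : (n : L) ≠ 0 ↔ (n : K) ≠ 0 := by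
  rw [← map_intCast (algebraMap K L) n, map_ne_zero_iff _ (algebraMap K L).injective]

/-- **`deg [n]_{A_L} = deg [n]_A` for `n` invertible in `K`** (unconditionally, `[n]_A` being then an
isogeny, `isIsogeny_zsmul_id_of_cast_ne_zero`). [folklore] -/
theorem kerRank_zsmul_id_baseChange (A : AbelianVariety K) (n : ℤ) (hn : (n : K) ≠ 0) :
    Hom.kerRank (n • 𝟙 (A.baseChange L)) = Hom.kerRank (n • 𝟙 A) :=
  kerRank_zsmul_id_baseChange_of L A (isIsogeny_zsmul_id_of_cast_ne_zero n hn)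

/-- The named fact `isIsogeny_zsmul_id` passes to base changes. [folklore] -/
theorem isIsogeny_zsmul_id_baseChange (A : AbelianVariety K) (h : isIsogeny_zsmul_id A) :
    isIsogeny_zsmul_id (A.baseChange L) := fun n hn =>
  isIsogeny_zsmul_id_baseChange_of L A (h n hn)

/-- **`deg [n]_A = n^{2g}` may be checked after any extension of the ground field**: given that
`[n]_A` is an isogeny for `n ≠ 0` (`isIsogeny_zsmul_id A`), the named fact `kerRank_zsmul_id` for
`A_L` is equivalent to that for `A` (`kerRank_zsmul_id_baseChange_of`, `dim_baseChange`).
[folklore] -/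
theorem kerRank_zsmul_id_iff_baseChange (A : AbelianVariety K) (h₀ : isIsogeny_zsmul_id A) :
    kerRank_zsmul_id (A.baseChange L) ↔ kerRank_zsmul_id A := by
  refine forall₂_congr fun n hn => ?_
  rw [kerRank_zsmul_id_baseChange_of L A (h₀ n hn), dim_baseChange]

/-- `kerRank_zsmul_id A` from `kerRank_zsmul_id A_L` (and `isIsogeny_zsmul_id A`). [folklore] -/
theorem kerRank_zsmul_id_of_baseChange (A : AbelianVariety K) (h₀ : isIsogeny_zsmul_id A)
    (h : kerRank_zsmul_id (A.baseChange L)) : kerRank_zsmul_id A :=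
  (kerRank_zsmul_id_iff_baseChange L A h₀).1 h

/-! ### Points: `A(L) = A_L(L)` as groups, and the torsion count -/

section Points

variable (A : AbelianVariety K)

/-- `Spec L` as a `K`-scheme is `Spec L` over itself pushed forward along `Spec L → Spec K` (the
identity on underlying schemes; Hartshorne II Ex. 2.7; cf. `AlgPoints.specOverIsoMapObj` of
`Motives/BaseChange`, stated there for a bare ring map). [folklore] -/
def specOverIsoMapObj : specOver K L ≅ (Over.map (bcSpec K L)).obj (specOver L L) :=
  Over.isoMk (Iso.refl _) (by
    simp only [Over.map_obj_left, Iso.refl_hom, Over.map_obj_hom, Over.mk_hom,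
      Algebra.algebraMap_self, CommRingCat.ofHom_id, Spec.map_id]
    rfl)

/-- **`A(L) ≃ A_L(L)`**: `L`-points of `A` over `K` are `L`-points of `A_L` over `L`, by the
universal property of `A_L = A ×_K L` (Görtz–Wedhorn I, Section (4.7): "mutually inverse
bijections, functorial in `T` and in `X`" `Hom_S(T, X) = Hom_{S'}(T, X_{(S')})` for an `S'`-scheme
`T`; Mathlib `Over.mapPullbackAdj`; Hartshorne II.3, Thm. 3.3; cf. `AlgPoints.baseChangeEquiv` of
`Motives/BaseChange`, stated there for a bare ring map `σ : K →+* L`). [folklore] -/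
def pointsEquiv : A.Points L ≃ (A.baseChange L).Points L :=
  ((specOverIsoMapObj L).homCongr (Iso.refl A.X)).trans
    ((Over.mapPullbackAdj (bcSpec K L)).homEquiv (specOver L L) A.X)

/-- `pointsEquiv` in terms of the unit of the adjunction `Over.map ⊣ Over.pullback`:
`P ↦ η ≫ (P|restricted)_L`. [folklore] -/
theorem pointsEquiv_apply (P : A.Points L) :
    A.pointsEquiv L P = (Over.mapPullbackAdj (bcSpec K L)).unit.app (specOver L L) ≫
      (bcFunctor K L).map ((specOverIsoMapObj L).inv ≫ P) := by
  simp only [pointsEquiv, Equiv.trans_apply, Iso.homCongr_apply, Iso.refl_hom, Category.comp_id]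
  rfl

/-- The point of `A_L(L)` attached to `P ∈ A(L)` lies over `P`: composing with the projection
`A_L → A` recovers `P` (Hartshorne II.3, Thm. 3.3). [folklore] -/
@[simp]
theorem pointsEquiv_symm_apply_left (Q : (A.baseChange L).Points L) :
    ((A.pointsEquiv L).symm Q).left = Q.left ≫ pullback.fst A.X.hom (bcSpec K L) := by
  simp only [pointsEquiv, Equiv.symm_trans_apply, Iso.homCongr_symm, Iso.homCongr_apply,
    Iso.refl_symm, Iso.refl_hom, Category.comp_id, Over.comp_left]
  erw [Adjunction.homEquiv_counit]
  simp [specOverIsoMapObj]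
  exact Category.id_comp _

/-- The point of `A_L(L)` attached to `P ∈ A(L)` lies over `P`. [folklore] -/
@[simp]
theorem pointsEquiv_apply_left_comp_fst (P : A.Points L) :
    (A.pointsEquiv L P).left ≫ pullback.fst A.X.hom (bcSpec K L) = P.left := by
  rw [← pointsEquiv_symm_apply_left, Equiv.symm_apply_apply]

/-- **`A(L) ≃ A_L(L)` is a group isomorphism**: the group law of `A_L` is the base change of that
of `A` (`Functor.map_mul` for the monoidal functor `Over.pullback`, and bilinearity of
composition, Mathlib `MonObj.comp_mul`). [folklore] -/
theorem pointsEquiv_mul (P Q : A.Points L) :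
    A.pointsEquiv L (P * Q) = A.pointsEquiv L P * A.pointsEquiv L Q := by
  rw [pointsEquiv_apply, pointsEquiv_apply, pointsEquiv_apply, MonObj.comp_mul,
    Functor.map_mul]
  exact MonObj.comp_mul _ _ _

/-- **`A(L) ≃* A_L(L)`** as a multiplicative equivalence (Hartshorne II.3, Thm. 3.3 with the
group structures of Mumford, *Abelian Varieties*, §4). [folklore] -/
def pointsMulEquiv : A.Points L ≃* (A.baseChange L).Points L :=
  { A.pointsEquiv L with map_mul' := A.pointsEquiv_mul L }

/-- `pointsMulEquiv` is `pointsEquiv` on elements. [folklore] -/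
@[simp]
theorem pointsMulEquiv_apply (P : A.Points L) : A.pointsMulEquiv L P = A.pointsEquiv L P := rfl

/-- **`#A_L[n](L) = #A[n](L)`**: the `n`-torsion of `A(L)` and of `A_L(L)` correspond under
`A(L) ≃* A_L(L)`. [folklore] -/
theorem natCard_torsionPoints_baseChange (n : ℤ) :
    Nat.card ((A.baseChange L).torsionPoints L n) = Nat.card (A.torsionPoints L n) := by
  refine (Nat.card_congr ((A.pointsMulEquiv L).toEquiv.subtypeEquiv fun P => ?_)).symm
  change P ∈ A.torsionPoints L n ↔ A.pointsMulEquiv L P ∈ (A.baseChange L).torsionPoints L n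
  rw [mem_torsionPoints_iff, mem_torsionPoints_iff, ← map_zpow, MulEquiv.map_eq_one_iff]

/-- **The torsion count may be checked after base change to `L`**: `#A[n](L) = n^{2g}` for
`A` over `K` (the named fact `natCard_torsionPoints_of_isAlgClosed A L`) follows from the same
statement for the abelian variety `A_L` over `L` (`natCard_torsionPoints_baseChange`,
`dim_baseChange`; an integer invertible in `K` is invertible in `L`). In particular all of
Görtz–Wedhorn II, Prop. 27.186–27.188 may be used over an algebraically closed ground field only
(Mumford's standing hypothesis in *Abelian Varieties*). [folklore] -/
theorem natCard_torsionPoints_of_isAlgClosed_of_baseChange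
    (h : natCard_torsionPoints_of_isAlgClosed (A.baseChange L) L) :
    natCard_torsionPoints_of_isAlgClosed A L := by
  intro _ n hn
  rw [← natCard_torsionPoints_baseChange, h n ((intCast_ne_zero_iff L n).2 hn), dim_baseChange]

/-- **`#A[n](L) = n^{2g}` from `deg [n]_{A_L} = n^{2g}`**: the named fact
`natCard_torsionPoints_of_isAlgClosed A L` follows from the single named fact `kerRank_zsmul_id`
for the base change `A_L` (`natCard_torsionPoints_of_isAlgClosed_of_kerRank` of
`Motives/AbelianVarietyLie` over `L`, and `natCard_torsionPoints_of_isAlgClosed_of_baseChange`).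
[folklore] -/
theorem natCard_torsionPoints_of_isAlgClosed_of_kerRank_baseChange
    (h : kerRank_zsmul_id (A.baseChange L)) : natCard_torsionPoints_of_isAlgClosed A L :=
  A.natCard_torsionPoints_of_isAlgClosed_of_baseChange L
    (natCard_torsionPoints_of_isAlgClosed_of_kerRank L h)

end Points

/-! ### Assembly over an algebraically closed ground field -/

section Assembly

variable (A : AbelianVariety K)

/-- **`deg [n]_A = n^{2g}` from the line-bundle facts over an extension field.** The named fact
`kerRank_zsmul_id A` follows from `isIsogeny_zsmul_id A` together with, *over `L`*: asymptotic
Riemann–Roch (Görtz–Wedhorn II, Prop. 23.83), the degree of pullbacks (Prop. 23.84), `[n]^*D ∼ n²D`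
for symmetric `D` on `A_L` (Prop. 27.184) and a symmetric ample divisor on `A_L` (Prop. 27.174 with
Rem. 27.185) — `kerRank_zsmul_id_of_facts_of_isIsogeny` (`Motives/AbelianVarietyDegree`) for `A_L`
and `kerRank_zsmul_id_of_baseChange`. [cite: GortzWedhorn2023, Prop. 27.186] -/
theorem kerRank_zsmul_id_of_facts_baseChange (h₀ : isIsogeny_zsmul_id A)
    (h₁ : CartierDivisor.asymptoticRiemannRoch_of_isAmple.{u})
    (h₂ : CartierDivisor.asympDegree_pullback_eq.{u})
    (h₃ : (A.baseChange L).pullback_zsmul_id_linEquiv)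
    (h₄ : (A.baseChange L).exists_isAmple_symmetric) : kerRank_zsmul_id A :=
  kerRank_zsmul_id_of_baseChange L A h₀
    (kerRank_zsmul_id_of_facts_of_isIsogeny (isIsogeny_zsmul_id_baseChange L A h₀) h₁ h₂ h₃ h₄)

/-- **`deg [n]_A = n^{2g}` over any field from projectivity over the algebraic closure.** The named
fact `kerRank_zsmul_id A` for `A` over `K` follows from `isIsogeny_zsmul_id A`, the two universal
line-bundle facts (Görtz–Wedhorn II, Prop. 23.83, Prop. 23.84), the theorem of the cube for `A_{K̄}`
(Prop. 27.184) and projectivity of `A_{K̄}` — Mumford, *Abelian Varieties*, §6, Application 1,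
p. 62, *as printed* (over an algebraically closed field) —, `K̄ = AlgebraicClosure K`; no descent of
projectivity or ampleness (Görtz–Wedhorn I, Prop. 14.57/14.58) is needed.
[cite: GortzWedhorn2023, Prop. 27.186] [cite: MumfordAV1970, §6 Application 1 (p. 62)] -/
theorem kerRank_zsmul_id_of_isProjectiveOver_algebraicClosure (h₀ : isIsogeny_zsmul_id A)
    (h₁ : CartierDivisor.asymptoticRiemannRoch_of_isAmple.{u})
    (h₂ : CartierDivisor.asympDegree_pullback_eq.{u})
    (h₃ : (A.baseChange (AlgebraicClosure K)).pullback_zsmul_id_linEquiv)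
    (h₄ : IsProjectiveOver (A.baseChange (AlgebraicClosure K)).X) : kerRank_zsmul_id A :=
  A.kerRank_zsmul_id_of_facts_baseChange (AlgebraicClosure K) h₀ h₁ h₂ h₃
    (exists_isAmple_symmetric_of_isProjectiveOver _ h₄)

/-- The same with the named facts quantified over all abelian varieties over `K̄`:
`isIsogeny_zsmul_id A`, Görtz–Wedhorn II Prop. 23.83 and 23.84, the theorem of the cube over `K̄`
and `AbelianVariety.isProjectiveOver` over `K̄` (`Motives/CyclesAbelianVarieties`) imply
`kerRank_zsmul_id A`. [cite: GortzWedhorn2023, Prop. 27.186] -/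
theorem kerRank_zsmul_id_of_namedFacts_algebraicClosure (h₀ : isIsogeny_zsmul_id A)
    (h₁ : CartierDivisor.asymptoticRiemannRoch_of_isAmple.{u})
    (h₂ : CartierDivisor.asympDegree_pullback_eq.{u})
    (h₃ : ∀ B : AbelianVariety (AlgebraicClosure K), B.pullback_zsmul_id_linEquiv)
    (h₄ : AbelianVariety.isProjectiveOver (k := AlgebraicClosure K)) : kerRank_zsmul_id A :=
  A.kerRank_zsmul_id_of_isProjectiveOver_algebraicClosure h₀ h₁ h₂ (h₃ _) (h₄ _)

/-- **`#A[n](L) = n^{2g}` over an algebraically closed `L ⊇ K` from the facts over `L` alone**: the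
named fact `natCard_torsionPoints_of_isAlgClosed A L` follows from Görtz–Wedhorn II, Prop. 23.83 and
23.84, the theorem of the cube for `A_L` (Prop. 27.184) and projectivity of abelian varieties over
the algebraically closed field `L` (Mumford §6, Application 1, as printed) —
`natCard_torsionPoints_of_isAlgClosed_of_namedFacts` (`Motives/AbelianVarietyDegree`) for `A_L`
transported along `A(L) ≃* A_L(L)`. No hypothesis on `[n]_A` for `p ∣ n` enters.
[cite: GortzWedhorn2023, Prop. 27.188 (1)] [cite: MumfordAV1970, §6 Application 1 (p. 62) and Application 3 (p. 64)] -/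
theorem natCard_torsionPoints_of_isAlgClosed_of_namedFacts_baseChange
    (h₁ : CartierDivisor.asymptoticRiemannRoch_of_isAmple.{u})
    (h₂ : CartierDivisor.asympDegree_pullback_eq.{u})
    (h₃ : (A.baseChange L).pullback_zsmul_id_linEquiv)
    (h₄ : AbelianVariety.isProjectiveOver (k := L)) : natCard_torsionPoints_of_isAlgClosed A L :=
  A.natCard_torsionPoints_of_isAlgClosed_of_baseChange L
    (natCard_torsionPoints_of_isAlgClosed_of_namedFacts L h₁ h₂ h₃ h₄)

end Assembly

end AbelianVariety

end Literature.AlgebraicGeometry.Motives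

end
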